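import Literature.MathematicalPhysics.QuantumLattice.GrassmannDeletionExpansion
import Mathlib.Data.Nat.Factorial.Basic
import HarnessLib

/-!
# Counting deletion patterns: shapes, appended lists, the output-label sum, admissible-step counts

Topic `Literature/MathematicalPhysics/QuantumLattice`; the label-independent combinatorics of the deletion
patterns of `GrassmannDeletionExpansion.lean` (`patSet ops S`, `patWeight Z ops π`) needed to sum the
per-script kernel bound of `GrassmannLaplacianScriptBound.lean` over the labels (Benfatto–Giuliani–Mastropietro
2006, proof of (2.77): "the number of terms is bounded by `C^N ∏_ℓ 2|P_u||P_{u'}|`").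

* `DelOp.isLap`, `patSet_congr` — the pattern set depends on the operations only through their shapes
  (derivative / Laplacian), in particular not on the output labels;
* `card_stepSet_ext` (`= |S|`), `card_filter_stepSet_lap_le` — the ordered pairs of positions whose clusters
  form a prescribed line `{a, b}` number `≤ 2 |cluster a| |cluster b|`;
* `patWeight_append` — the weight of a pattern of `ops ++ ops'` factorises (first `|ops|` steps, then the rest);
  `patWeight_map_ext` — the weight of the derivative steps `∂_{W_0} ⋯` is `∏_j [Z_{p_j} = W_j]`, and
  **`sum_filter_patWeight_map_ext_le`** — summed over the output labels `W` with ONE slot `i` pinned at `w`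
  it is `≤ [Z_{p_i} = w]`;
* `stepsOK` (`stepsOK_append`, `stepsOK_replicate_true`), `countBound`, **`card_filter_patSet_le`** — if at every
  step at most `B_t(|S'|)` of the available steps are admissible, the admissible patterns number `≤ ∏_t B_t`
  (telescoping set sizes), `countBound_append`, `countBound_exts` (`= |S| (|S|-1) ⋯`, the falling factorial),
  `countBound_consts`.

Everything is proved; no named fact. [folklore]

## Sources

G. Benfatto, A. Giuliani, V. Mastropietro, Ann. Henri Poincaré 7 (2006) 809–898, proof of (2.77)
(`BenfattoGiulianiMastropietro2006`).
-/

noncomputable section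

namespace Literature.MathematicalPhysics.QuantumLattice

open GrassmannAlgebra Finset

variable {𝕜 : Type*} [RCLike 𝕜] {Γ : Type*} [Fintype Γ] [DecidableEq Γ] {N : ℕ}

/-! ### Shapes -/

namespace DelOp

/-- The shape of an operation: `true` for a Laplacian, `false` for a derivative. [folklore] -/
def isLap : DelOp Γ 𝕜 → Bool
  | ext _ => false
  | lap _ => true

omit [RCLike 𝕜] [Fintype Γ] [DecidableEq Γ] in
/-- The steps depend only on the shape. [folklore] -/
theorem stepSet_eq_of_isLap (S : Finset (Fin N)) : ∀ {o o' : DelOp Γ 𝕜}, o.isLap = o'.isLap → stepSet S o = stepSet S o'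
  | ext _, ext _, _ => rfl
  | lap _, lap _, _ => rfl
  | ext _, lap _, h => absurd h (by simp [isLap])
  | lap _, ext _, h => absurd h (by simp [isLap])

omit [RCLike 𝕜] [Fintype Γ] [DecidableEq Γ] in
/-- The remaining positions depend only on the shape. [folklore] -/
theorem rest_eq_of_isLap (S : Finset (Fin N)) : ∀ {o o' : DelOp Γ 𝕜}, o.isLap = o'.isLap → rest S o = rest S o'
  | ext _, ext _, _ => rfl
  | lap _, lap _, _ => rfl
  | ext _, lap _, h => absurd h (by simp [isLap])
  | lap _, ext _, h => absurd h (by simp [isLap])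

omit [RCLike 𝕜] [Fintype Γ] [DecidableEq Γ] in
/-- The cost depends only on the shape. [folklore] -/
theorem cost_eq_of_isLap : ∀ {o o' : DelOp Γ 𝕜}, o.isLap = o'.isLap → cost o = cost o'
  | ext _, ext _, _ => rfl
  | lap _, lap _, _ => rfl
  | ext _, lap _, h => absurd h (by simp [isLap])
  | lap _, ext _, h => absurd h (by simp [isLap])

omit [RCLike 𝕜] [Fintype Γ] [DecidableEq Γ] in
/-- A derivative has `|S|` steps. [folklore] -/
theorem card_stepSet_ext (S : Finset (Fin N)) (X : Γ) : (stepSet S (ext X : DelOp Γ 𝕜)).card = S.card := by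
  rw [card_eq_sum_ones, sum_stepSet_ext, ← card_eq_sum_ones]

omit [RCLike 𝕜] [Fintype Γ] [DecidableEq Γ] in
/-- **The ordered pairs of positions whose clusters form the line `{a, b}` number `≤ 2 |a| |b|`.** [folklore] -/
theorem card_filter_stepSet_lap_le {ι : Type*} [DecidableEq ι] (S : Finset (Fin N)) (C' : Matrix Γ Γ 𝕜) (vert : Fin N → ι)
    (a b : ι) :
    ((stepSet S (lap C' : DelOp Γ 𝕜)).filter fun pq => s(vert pq.2, vert pq.1) = s(a, b)).card ≤
      2 * ((univ.filter fun p => vert p = a).card * (univ.filter fun p => vert p = b).card) := by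
  set A := univ.filter fun p : Fin N => vert p = a
  set B := univ.filter fun p : Fin N => vert p = b
  calc ((stepSet S (lap C' : DelOp Γ 𝕜)).filter fun pq => s(vert pq.2, vert pq.1) = s(a, b)).card
      ≤ (B ×ˢ A ∪ A ×ˢ B).card := by
        refine card_le_card fun pq hpq => ?_
        rw [mem_filter, Sym2.eq_iff] at hpq
        rw [mem_union, mem_product, mem_product]
        rcases hpq.2 with ⟨h1, h2⟩ | ⟨h1, h2⟩
        · exact Or.inl ⟨mem_filter.2 ⟨mem_univ _, h2⟩, mem_filter.2 ⟨mem_univ _, h1⟩⟩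
        · exact Or.inr ⟨mem_filter.2 ⟨mem_univ _, h2⟩, mem_filter.2 ⟨mem_univ _, h1⟩⟩
    _ ≤ (B ×ˢ A).card + (A ×ˢ B).card := card_union_le _ _
    _ = 2 * (A.card * B.card) := by rw [card_product, card_product]; ring

end DelOp

/-! ### The pattern set depends only on the shapes -/

omit [RCLike 𝕜] [Fintype Γ] [DecidableEq Γ] in
/-- **Patterns depend on the operations only through their shapes.** [folklore] -/
theorem patSet_congr : ∀ {ops ops' : List (DelOp Γ 𝕜)}, ops.map DelOp.isLap = ops'.map DelOp.isLap →
    ∀ S : Finset (Fin N), patSet ops S = patSet ops' S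
  | [], [], _, _ => rfl
  | [], _ :: _, h, _ => absurd h (by simp)
  | _ :: _, [], h, _ => absurd h (by simp)
  | o :: ops, o' :: ops', h, S => by
    rw [List.map_cons, List.map_cons, List.cons_eq_cons] at h
    have hfib : (fun pq => patSet ops (DelOp.rest S o pq)) = fun pq => patSet ops' (DelOp.rest S o' pq) := by
      funext pq
      rw [DelOp.rest_eq_of_isLap S h.1, patSet_congr h.2]
    rw [patSet, patSet, DelOp.stepSet_eq_of_isLap S h.1, hfib]

/-! ### Weights of appended lists; the derivative steps and the output-label sum -/

omit [Fintype Γ] in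
/-- **The weight of a pattern of `ops ++ ops'` factorises.** [folklore] -/
theorem patWeight_append (Z : Fin N → Γ) : ∀ (ops ops' : List (DelOp Γ 𝕜)) (π : List (Fin N × Fin N)),
    patWeight Z (ops ++ ops') π = patWeight Z ops (π.take ops.length) * patWeight Z ops' (π.drop ops.length)
  | [], ops', π => by rw [List.nil_append, List.length_nil, List.take_zero, List.drop_zero, patWeight, one_mul]
  | o :: ops, ops', [] => by
    rw [List.cons_append, List.take_nil, List.drop_nil, patWeight, patWeight, zero_mul]
  | o :: ops, ops', pq :: π => by
    rw [List.cons_append, patWeight_cons, List.length_cons, List.take_succ_cons, List.drop_succ_cons, patWeight_cons,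
      patWeight_append Z ops ops' π, mul_assoc]

omit [Fintype Γ] in
/-- **The weight of the derivative steps**: `weight(Z, ∂_{W_0} ⋯ ∂_{W_{r-1}}, π) = ∏_j [Z_{p_j} = W_j]` (zero if
the pattern is too short). [folklore] -/
theorem patWeight_map_ext (Z : Fin N → Γ) : ∀ {r : ℕ} (W : Fin r → Γ) (π : List (Fin N × Fin N)),
    patWeight Z ((List.ofFn W).map DelOp.ext : List (DelOp Γ 𝕜)) π =
      ∏ j : Fin r, if (π[(j : ℕ)]?).map (fun pq => Z pq.1) = some (W j) then (1 : ℝ) else 0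
  | 0, W, π => by rw [List.ofFn_zero, List.map_nil, patWeight, Fin.prod_univ_zero]
  | r + 1, W, [] => by
    rw [List.ofFn_succ, List.map_cons, patWeight, Fin.prod_univ_succ]
    simp
  | r + 1, W, pq :: π => by
    rw [List.ofFn_succ, List.map_cons, patWeight_cons, Fin.prod_univ_succ, patWeight_map_ext Z (fun j => W j.succ) π]
    congr 1
    · simp only [DelOp.weight, Fin.val_zero, List.getElem?_cons_zero, Option.map_some, Option.some.injEq]

omit [Fintype Γ] in
/-- The weight of the derivative steps vanishes on patterns that are too short. [folklore] -/
theorem patWeight_map_ext_eq_zero_of_lt (Z : Fin N → Γ) {r : ℕ} (W : Fin r → Γ) (π : List (Fin N × Fin N)) (h : π.length < r) :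
    patWeight Z ((List.ofFn W).map DelOp.ext : List (DelOp Γ 𝕜)) π = 0 := by
  rw [patWeight_map_ext]
  refine prod_eq_zero (mem_univ ⟨π.length, h⟩) ?_
  rw [if_neg]
  simp

omit [Fintype Γ] in
/-- **The output-label sum with one slot pinned**: `Σ_{W : W_i = w} weight(Z, ∂_W, π) ≤ [Z_{p_i} = w]`. [folklore] -/
theorem sum_filter_patWeight_map_ext_le [Fintype Γ] (Z : Fin N → Γ) {r : ℕ} (i : Fin r) (w : Γ) (π : List (Fin N × Fin N)) :
    ∑ W ∈ univ.filter (fun W : Fin r → Γ => W i = w), patWeight Z ((List.ofFn W).map DelOp.ext : List (DelOp Γ 𝕜)) π ≤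
      if (π[(i : ℕ)]?).map (fun pq => Z pq.1) = some w then 1 else 0 := by
  simp only [patWeight_map_ext]
  by_cases h : ∀ j : Fin r, ((π[(j : ℕ)]?).map fun pq => Z pq.1).isSome
  · set z : Fin r → Γ := fun j => ((π[(j : ℕ)]?).map fun pq => Z pq.1).get (h j) with hz
    have hsome : ∀ j : Fin r, (π[(j : ℕ)]?).map (fun pq => Z pq.1) = some (z j) := fun j => (Option.some_get (h j)).symm
    have hprod : ∀ W : Fin r → Γ, (∏ j : Fin r, if (π[(j : ℕ)]?).map (fun pq => Z pq.1) = some (W j) then (1 : ℝ) else 0) =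
        if z = W then 1 else 0 := fun W => by
      rw [prod_boole]
      simp only [hsome, Option.some.injEq, mem_univ, true_implies]
      exact if_congr funext_iff.symm rfl rfl
    simp only [hprod]
    rw [sum_ite_eq]
    simp only [mem_filter, mem_univ, true_and, hsome, Option.some.injEq]
    exact le_rfl
  · obtain ⟨j, hj⟩ := not_forall.1 h
    rw [Option.not_isSome_iff_eq_none] at hj
    refine le_trans (le_of_eq (sum_eq_zero fun W _ => prod_eq_zero (mem_univ j) ?_)) (by split_ifs <;> norm_num)
    rw [hj, if_neg (by simp)]

/-! ### Counting admissible patterns -/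

/-- A pattern is **admissible** for a list of step predicates if it has a step satisfying each predicate, in
order. [folklore] -/
def stepsOK : List (Fin N × Fin N → Bool) → List (Fin N × Fin N) → Bool
  | [], _ => true
  | _ :: _, [] => false
  | P :: Ps, pq :: π => P pq && stepsOK Ps π

/-- Admissibility for appended predicate lists factorises. [folklore] -/
theorem stepsOK_append : ∀ (Ps Ps' : List (Fin N × Fin N → Bool)) (π : List (Fin N × Fin N)),
    stepsOK (Ps ++ Ps') π = (stepsOK Ps (π.take Ps.length) && stepsOK Ps' (π.drop Ps.length))
  | [], Ps', π => by simp [stepsOK]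
  | P :: Ps, Ps', [] => by simp [stepsOK]
  | P :: Ps, Ps', pq :: π => by
    rw [List.cons_append, stepsOK, List.length_cons, List.take_succ_cons, List.drop_succ_cons, stepsOK, stepsOK_append Ps Ps' π,
      Bool.and_assoc]

/-- Trivial predicates only check the length. [folklore] -/
theorem stepsOK_replicate_true : ∀ (r : ℕ) (π : List (Fin N × Fin N)),
    stepsOK (List.replicate r fun _ => true) π = decide (r ≤ π.length)
  | 0, π => by simp [stepsOK]
  | r + 1, [] => by rw [List.replicate_succ, stepsOK]; simp
  | r + 1, pq :: π => by
    rw [List.replicate_succ, stepsOK, stepsOK_replicate_true r π, Bool.true_and, List.length_cons]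
    simp

/-- The **count bound** of a list of operations with per-step bounds `B_t` (functions of the number of available
positions): `B_0(m) · B_1(m - cost_0) · ⋯`. [folklore] -/
def countBound : List (DelOp Γ 𝕜 × (ℕ → ℕ)) → ℕ → ℕ
  | [], _ => 1
  | ob :: L, m => ob.2 m * countBound L (m - ob.1.cost)

omit [RCLike 𝕜] [Fintype Γ] [DecidableEq Γ] in
/-- The count bound of appended lists. [folklore] -/
theorem countBound_append : ∀ (L L' : List (DelOp Γ 𝕜 × (ℕ → ℕ))) (m : ℕ),
    countBound (L ++ L') m = countBound L m * countBound L' (m - totalCost (L.map Prod.fst))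
  | [], L', m => by simp [countBound, totalCost]
  | ob :: L, L', m => by
    rw [List.cons_append, countBound, countBound, countBound_append L L', mul_assoc, List.map_cons, totalCost, totalCost,
      List.map_cons, List.sum_cons, Nat.sub_sub]

omit [RCLike 𝕜] [Fintype Γ] [DecidableEq Γ] in
/-- The count bound of `r` derivatives with the trivial per-step bound `m` is the falling factorial
`m (m-1) ⋯ (m-r+1)`. [folklore] -/
theorem countBound_exts : ∀ {r : ℕ} (W : Fin r → Γ) (m : ℕ),
    countBound ((List.ofFn W).map fun X => ((DelOp.ext X : DelOp Γ 𝕜), id)) m = m.descFactorial r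
  | 0, W, m => by simp [countBound]
  | r + 1, W, m => by
    rw [List.ofFn_succ, List.map_cons, countBound, countBound_exts (fun j => W j.succ)]
    cases m with
    | zero => simp
    | succ m => rw [show (DelOp.ext (W 0), (id : ℕ → ℕ)).2 (m + 1) * (m + 1 - (DelOp.ext (W 0), (id : ℕ → ℕ)).1.cost).descFactorial r = (m + 1) * (m + 1 - 1).descFactorial r from rfl, Nat.add_sub_cancel, Nat.succ_descFactorial_succ]

omit [RCLike 𝕜] [Fintype Γ] [DecidableEq Γ] in
/-- The count bound of constant per-step bounds is their product. [folklore] -/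
theorem countBound_consts {α : Type*} (o : α → DelOp Γ 𝕜) (c : α → ℕ) : ∀ (l : List α) (m : ℕ),
    countBound (l.map fun a => (o a, fun _ => c a)) m = (l.map c).prod
  | [], m => by simp [countBound]
  | a :: l, m => by rw [List.map_cons, countBound, countBound_consts o c l, List.map_cons, List.prod_cons]

omit [RCLike 𝕜] [Fintype Γ] [DecidableEq Γ] in
/-- **Counting admissible patterns**: if at most `B_t(|S'|)` steps of operation `t` on any position set `S'` are
admissible, the admissible patterns on `S` number `≤ countBound`. [folklore] -/
theorem card_filter_patSet_le : ∀ (L : List (DelOp Γ 𝕜 × (Fin N × Fin N → Bool) × (ℕ → ℕ))),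
    (∀ x ∈ L, ∀ S' : Finset (Fin N), ((DelOp.stepSet S' x.1).filter fun pq => x.2.1 pq).card ≤ x.2.2 S'.card) →
    ∀ S : Finset (Fin N),
      ((patSet (L.map Prod.fst) S).filter fun π => stepsOK (L.map fun x => x.2.1) π).card ≤
        countBound (L.map fun x => (x.1, x.2.2)) S.card
  | [], _, S => by simp [patSet, stepsOK, countBound]
  | x :: L, hB, S => by
    rw [List.map_cons, List.map_cons, List.map_cons, countBound, card_eq_sum_ones, sum_filter, sum_patSet_cons]
    have ih := card_filter_patSet_le L (fun x' hx' => hB x' (List.mem_cons_of_mem _ hx'))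
    calc ∑ pq ∈ DelOp.stepSet S x.1, ∑ π ∈ patSet (L.map Prod.fst) (DelOp.rest S x.1 pq),
          (if stepsOK (x.2.1 :: L.map fun x => x.2.1) (pq :: π) = true then 1 else 0)
        = ∑ pq ∈ DelOp.stepSet S x.1, if x.2.1 pq = true then
            ((patSet (L.map Prod.fst) (DelOp.rest S x.1 pq)).filter fun π => stepsOK (L.map fun x => x.2.1) π).card else 0 := by
          refine sum_congr rfl fun pq _ => ?_
          rw [card_eq_sum_ones, sum_filter]
          split_ifs with h
          · exact sum_congr rfl fun π _ => by simp [stepsOK, h]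
          · exact sum_eq_zero fun π _ => by simp [stepsOK, h]
      _ ≤ ∑ pq ∈ DelOp.stepSet S x.1, if x.2.1 pq = true then countBound (L.map fun x => (x.1, x.2.2)) (S.card - x.1.cost) else 0 := by
          refine sum_le_sum fun pq hpq => ?_
          split_ifs
          · rw [← DelOp.card_rest x.1 hpq]; exact ih _
          · exact le_rfl
      _ = ((DelOp.stepSet S x.1).filter fun pq => x.2.1 pq).card * countBound (L.map fun x => (x.1, x.2.2)) (S.card - x.1.cost) := by
          rw [← sum_filter, sum_const, smul_eq_mul]
      _ ≤ x.2.2 S.card * countBound (L.map fun x => (x.1, x.2.2)) (S.card - x.1.cost) :=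
          Nat.mul_le_mul_right _ (hB x (List.mem_cons_self ..) S)

end Literature.MathematicalPhysics.QuantumLattice
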